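import Summits.QuantumFields.YangMills.Theorems.BalabanUVNodesN22AtRecord
import Summits.QuantumFields.YangMills.Theorems.BalabanUVNodesN22KnitStrip

/-!
# BalabanUVNodes ∕ node N22 = NE9 — THE «AT-RECORD» CLOSERS OF ROAD 3 IN THE STRIP ∕ DERIVATIVE-LETTER CURRENCY: `S_N22 RRec` for every
# rate-record predicate whose U3 bundles carry the slot «(P) + (O) at the bundle's NE5 rate θ + analyticity of the young-coupling sections on a
# set containing the open `r`-discs about the window with a DERIVATIVE letter `L·μ^{age}·e^{−κd}` at ANY geometric growth μ» with the
# rate-`θ^{1−s}μ^{s}` moduli (`BalabanUVNodesN22KnitStrip` BY NAME), and the tower form with node N18 below the level (companion of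
# `BalabanUVNodesN22AtRecord` ∕ `…AtRecordAnalytic`; plan word (W2))

Cell `pub-ymgap`, HUMAN RULING D-0062 (Track A), seat `pub-ymgap-dag-n22-a` (-a KNIT-BY-NAME), generation 3.  THEOREMS ONLY; imports the seat's
AT-RECORD module (`S_N22` readings ∕ guards ∕ faces) and the strip-currency knit.  `--supports stmt-QuantumFields-19182`.

HONEST FRAMING.  By-name bookkeeping; no `RRec` home exists (R422 (A)(P2)), so nothing here discharges N22; NE5 ∕ NE9 NOT IN PRINT, NOT PROVED;
instance on Bałaban's localized `E^{(j)}(X)` 0∕1 (W1); count-neutral; one finite four-torus programme at fixed ε — NOT infinite volume, NOT OS on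
ℝ⁴, NOT a mass gap, NOT Clay.  0 `sorry`, 0 `def`, standard axioms.

WHAT.
* §1 `n22At_of_oscStrip` — a U3 bundle with window `Window γ`, (P), (O) with constant `C₀ > 0` at the bundle's rate `θ > 0`, (A′) analyticity of every
  young-coupling section on a set containing the OPEN discs of radius `r` about `]0, γ]` with the derivative letter `L·μ^{age−1}·e^{−κd(X)}`
  (`θ ≤ μ`, `C₀ ≤ 2Lr`), a parameter `s ∈ ]0, 1[`, and letters `ω = θ^{1−s}μ^{s}`, `Λ k i = C₉·ω^{k−i}`,
  `C₉ = (32∕(s²·min(r∕2, γ∕2)))·C₀^{1−s}(2Lr)^{s}∕ω` carries `N22At` (`N22KnitStrip.ne9_and_fadingMemory_of_osc_strip`); **`s_N22_of_oscStrip`** —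
  hence `S_N22 RRec` for EVERY `RRec` whose bundles carry that slot (combine with `YMDAG.N22.s_N22_of_refines`).
* §2 `n22At_level_of_n18At_below_strip` — the tower form: the bundle «level `k` of ne9's tower of carriers» with the strip-road letters carries
  `N22At` from `N18At` of the bundles «level `k′ < k`» + (P) + (A′) (`…_of_ne5_below_strip`); **`s_N22_of_towerSlot_strip`**.
* §3 CHOOSING `s` (dag-ref-B READ-267 ∕ READ-278 pins: `FadingMemory` carries no `ω < 1`): `exists_fading_rate` — `0 < θ < 1 ≤∕≥ μ` (any `μ ≥ θ`)
  gives an `s ∈ ]0,1[` with `θ^{1−s}μ^{s} < 1`; `one_le_rate_of_one_le` — none if `θ ≥ 1`.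
* §4 CURRENCY ORDERING: `stripLetter_of_supLetter` — the UNCENTRED letter (A) of `…AtRecordAnalytic` on the closed `r`-discs implies (A′) on the open
  `r∕2`-discs with `L = 2M∕r` (Cauchy; module 13 §5 `letters_of_norm_le` BY NAME); `ne9_and_fadingMemory_of_osc_analytic_via_strip` — module 10's
  headline re-derived through the strip road (same rate, `r₁ = min(r∕4, γ∕2)`): (A′) is the weakest of ROAD 3's three E-side currencies.
READING (census v1.4): on this road an instancing `RRec` must carry for N22 — (P) (printed words), (A′) = the printed TYPE «(or analytic)»
([Balaban1987RG1] p. 263; p. 266, plural) in EACH young coupling on a complex neighbourhood containing discs of a FIXED radius about the whole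
window, with a derivative letter of at-most-geometric growth (body-level: the twin seat's `B12Eq213AnalyticHistory` — fixed strip, growth
`(cos m)^{−1}`; localized = W1), and EITHER (O) OR the tower identification with N18 below; NO smallness or growth condition on the E-side.

References (TYPES only): [Balaban1987RG1] = T. Bałaban, Commun. Math. Phys. **109** (1987) 249–301 — p. 256, Thm 1 p. 259, p. 263, p. 266, p. 298.
-/

noncomputable section

namespace YMDAG.N22

open Set Metric
open scoped BigOperators
open Literature.MathematicalPhysics.QuantumFieldTheory.Balaban1983to89
open Literature.MathematicalPhysics.QuantumFieldTheory.Balaban1983to89.T4Continuum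
open Literature.MathematicalPhysics.QuantumFieldTheory.Balaban1983to89.T4OutputRate
open Summit.QuantumFields.BalabanUV.T4Continuum.NE9.TowerCarriers (TowerData prepend)
open Summit.QuantumFields.YangMills.BalabanUVNodes.N22KnitStrip
  (ne9_and_fadingMemory_of_osc_strip ne9_fadingMemory_at_level_of_ne5_below_strip)
open Literature.MathematicalPhysics.QuantumFieldTheory.Balaban1983to89.B12Eq213AnalyticHistory (letters_of_norm_le)
open YMDAG.UVSplit

variable {N : ℕ} [NeZero N]

/-! ## §1 The strip slot carries `N22At`; `S_N22` for every `RRec` carrying it -/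

/-- **THE STRIP SLOT CARRIES `N22At`.**  A U3 bundle with window `Window γ`, (P), (O) with constant `C₀ > 0` at the bundle's NE5 rate `θ > 0`, (A′)
analyticity of the young-coupling sections on a set containing the open `r`-discs about `]0, γ]` with the derivative letter
`L·μ^{scale X − 1 − i}·e^{−κd(X)}` (`θ ≤ μ`, `C₀ ≤ 2Lr`), a parameter `0 < s < 1`, fading letter `ω = θ^{1−s}μ^{s}`, moduli `Λ k i = C₉·ω^{k−i}`,
`C₉ = (32∕(s²·min(r∕2, γ∕2)))·C₀^{1−s}(2Lr)^{s}∕ω` carries `N22At` — §2's headline BY NAME. [folklore] -/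
theorem n22At_of_oscStrip (u : U3Carriers) {C₀ L μ r s : ℝ} (hW : u.W = Window u.γ)
    (hP : PrefixDependenceOn u.EA (Window u.γ))
    (hO : ∀ g ∈ Window u.γ, ∀ g' ∈ Window u.γ, ∀ (U : u.C.BgA) (X : u.C.Dom) (a : ℕ), a ≤ u.C.scale X →
      (∀ n, a ≤ n → g n = g' n) → |u.EA g U X - u.EA g' U X| ≤ C₀ * u.θ ^ (u.C.scale X - a) * Real.exp (-(u.κ * u.C.d X)))
    (hA : ∀ g ∈ Window u.γ, ∀ (U : u.C.BgA) (X : u.C.Dom) (i : ℕ), i < u.C.scale X → ∃ (F : ℂ → ℂ) (Dset : Set ℂ),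
      DifferentiableOn ℂ F Dset ∧ (∀ z ∈ Dset, ‖deriv F z‖ ≤ L * μ ^ (u.C.scale X - 1 - i) * Real.exp (-(u.κ * u.C.d X))) ∧
      (∀ t ∈ Ioc (0 : ℝ) u.γ, ball (t : ℂ) r ⊆ Dset) ∧ (∀ t ∈ Ioc (0 : ℝ) u.γ, F t = (u.EA (Function.update g i t) U X : ℂ)))
    (hC₀ : 0 < C₀) (hθ : 0 < u.θ) (hL : 0 < L) (hθμ : u.θ ≤ μ) (hCL : C₀ ≤ 2 * (L * r)) (hr : 0 < r) (hγ : 0 < u.γ) (hs0 : 0 < s)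
    (hs1 : s < 1) (hω : u.ω = u.θ ^ (1 - s) * μ ^ s) (hΛ : u.Λ = fun k i => u.C₉ * u.ω ^ (k - i))
    (hC₉ : u.C₉ = 32 / (s ^ 2 * min (r / 2) (u.γ / 2)) * (C₀ ^ (1 - s) * (2 * (L * r)) ^ s) / (u.θ ^ (1 - s) * μ ^ s)) :
    N22At u := by
  show NE9 u.EA u.W u.κ u.Λ ∧ FadingMemory u.C₉ u.ω u.Λ
  rw [hW, hΛ, hC₉, hω]
  exact ne9_and_fadingMemory_of_osc_strip hP hO hA hC₀ hθ hL hθμ hCL hr hγ hs0 hs1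

/-- **`S_N22 RRec` FOR EVERY `RRec` WHOSE BUNDLES CARRY THE STRIP SLOT** (refinement-generic; with `YMDAG.N22.s_N22_of_refines` one application of a
refinement lemma closes any refinement). [folklore] -/
theorem s_N22_of_oscStrip (RRec : RateRecordPred N)
    (hslot : ∀ (F : T4Family) (D : Datum F N) (g₀ : ℕ → ℝ) (os : List (ULoop F)) (R : RateCarriers N), RRec F D g₀ os R →
      ∃ C₀ L μ r s : ℝ, R.u3.W = Window R.u3.γ ∧ PrefixDependenceOn R.u3.EA (Window R.u3.γ) ∧
        (∀ g ∈ Window R.u3.γ, ∀ g' ∈ Window R.u3.γ, ∀ (U : R.u3.C.BgA) (X : R.u3.C.Dom) (a : ℕ), a ≤ R.u3.C.scale X →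
          (∀ n, a ≤ n → g n = g' n) →
            |R.u3.EA g U X - R.u3.EA g' U X| ≤ C₀ * R.u3.θ ^ (R.u3.C.scale X - a) * Real.exp (-(R.u3.κ * R.u3.C.d X))) ∧
        (∀ g ∈ Window R.u3.γ, ∀ (U : R.u3.C.BgA) (X : R.u3.C.Dom) (i : ℕ), i < R.u3.C.scale X → ∃ (Fz : ℂ → ℂ) (Dset : Set ℂ),
          DifferentiableOn ℂ Fz Dset ∧
          (∀ z ∈ Dset, ‖deriv Fz z‖ ≤ L * μ ^ (R.u3.C.scale X - 1 - i) * Real.exp (-(R.u3.κ * R.u3.C.d X))) ∧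
          (∀ t ∈ Ioc (0 : ℝ) R.u3.γ, ball (t : ℂ) r ⊆ Dset) ∧
          (∀ t ∈ Ioc (0 : ℝ) R.u3.γ, Fz t = (R.u3.EA (Function.update g i t) U X : ℂ))) ∧
        0 < C₀ ∧ 0 < R.u3.θ ∧ 0 < L ∧ R.u3.θ ≤ μ ∧ C₀ ≤ 2 * (L * r) ∧ 0 < r ∧ 0 < R.u3.γ ∧ 0 < s ∧ s < 1 ∧
        R.u3.ω = R.u3.θ ^ (1 - s) * μ ^ s ∧ (R.u3.Λ = fun k i => R.u3.C₉ * R.u3.ω ^ (k - i)) ∧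
        R.u3.C₉ = 32 / (s ^ 2 * min (r / 2) (R.u3.γ / 2)) * (C₀ ^ (1 - s) * (2 * (L * r)) ^ s) / (R.u3.θ ^ (1 - s) * μ ^ s)) :
    S_N22 RRec := by
  intro F D g₀ os R hR
  obtain ⟨C₀, L, μ, r, s, hW, hP, hO, hA, hC₀, hθ, hL, hθμ, hCL, hr, hγ, hs0, hs1, hω, hΛ, hC₉⟩ := hslot F D g₀ os R hR
  exact n22At_of_oscStrip R.u3 hW hP hO hA hC₀ hθ hL hθμ hCL hr hγ hs0 hs1 hω hΛ hC₉

/-! ## §2 The tower form: node N18 below the level + (P) + the derivative letter -/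

/-- **THE STRIP SLOT ALONG THE TOWER, AT THE RECORD'S BUNDLES**: the bundle «level `k` of ne9's tower of carriers» with the strip-road letters
(`ω = θ^{1−s}μ^{s}`, `Λ a i = C₉·ω^{a−i}`, `C₉ = (32∕(s²·min(r∕2, γ∕2)))·(2C₅∕(1−θ))^{1−s}(2Lr)^{s}∕ω`) carries `N22At` as soon as the bundles «level
`k′`», `k′ < k`, carry `N18At` (node N18 BY NAME; `C₅ > 0`, `0 < θ < 1`) and `E k` has (P) and the derivative letter (A′) with bounds
`L·μ^{age−1}·e^{−κd}` on a set containing the open `r`-discs about the window (`θ ≤ μ`, `2C₅∕(1−θ) ≤ 2Lr`). [folklore] -/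
theorem n22At_level_of_n18At_below_strip (T : TowerData) (E : ℕ → (ℕ → ℝ) → T.B → T.Dom → ℝ) {γ κ θ C₅ L μ r s cr ρ' : ℝ}
    (hC : 0 < C₅) (hθ0 : 0 < θ) (hθ1 : θ < 1) (k : ℕ)
    (h18 : ∀ k' : ℕ, k' < k →
      N18At ⟨T.level k', Window γ, γ, κ, E k', fun b g U X => E (k' + 1) (prepend b g) U X, θ, C₅,
        fun a i => 32 / (s ^ 2 * min (r / 2) (γ / 2)) * ((2 * C₅ / (1 - θ)) ^ (1 - s) * (2 * (L * r)) ^ s) / (θ ^ (1 - s) * μ ^ s)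
          * (θ ^ (1 - s) * μ ^ s) ^ (a - i),
        32 / (s ^ 2 * min (r / 2) (γ / 2)) * ((2 * C₅ / (1 - θ)) ^ (1 - s) * (2 * (L * r)) ^ s) / (θ ^ (1 - s) * μ ^ s),
        θ ^ (1 - s) * μ ^ s, cr, ρ'⟩)
    (hP : PrefixDependenceOn (C := T.level k) (E k) (Window γ))
    (hA : ∀ g ∈ Window γ, ∀ (U : (T.level k).BgA) (X : (T.level k).Dom) (i : ℕ), i < (T.level k).scale X → ∃ (F : ℂ → ℂ) (Dset : Set ℂ),
      DifferentiableOn ℂ F Dset ∧ (∀ z ∈ Dset, ‖deriv F z‖ ≤ L * μ ^ ((T.level k).scale X - 1 - i) * Real.exp (-(κ * (T.level k).d X))) ∧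
      (∀ t ∈ Ioc (0 : ℝ) γ, ball (t : ℂ) r ⊆ Dset) ∧ (∀ t ∈ Ioc (0 : ℝ) γ, F t = (E k (Function.update g i t) U X : ℂ)))
    (hL : 0 < L) (hθμ : θ ≤ μ) (hCL : 2 * C₅ / (1 - θ) ≤ 2 * (L * r)) (hr : 0 < r) (hγ : 0 < γ) (hs0 : 0 < s) (hs1 : s < 1) :
    N22At ⟨T.level k, Window γ, γ, κ, E k, fun b g U X => E (k + 1) (prepend b g) U X, θ, C₅,
      fun a i => 32 / (s ^ 2 * min (r / 2) (γ / 2)) * ((2 * C₅ / (1 - θ)) ^ (1 - s) * (2 * (L * r)) ^ s) / (θ ^ (1 - s) * μ ^ s)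
        * (θ ^ (1 - s) * μ ^ s) ^ (a - i),
      32 / (s ^ 2 * min (r / 2) (γ / 2)) * ((2 * C₅ / (1 - θ)) ^ (1 - s) * (2 * (L * r)) ^ s) / (θ ^ (1 - s) * μ ^ s),
      θ ^ (1 - s) * μ ^ s, cr, ρ'⟩ := by
  have h5 : ∀ k' : ℕ, k' < k → ∀ b : ℝ, 0 < b → b ≤ γ →
      NE5 (C := T.level k') (E k') (fun g U X => E (k' + 1) (prepend b g) U X) (Window γ) κ θ C₅ :=
    fun k' hk' b hb0 hbγ => h18 k' hk' b hb0 hbγ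
  exact ne9_fadingMemory_at_level_of_ne5_below_strip T hC hθ0 hθ1 k h5 hP hA hL hθμ hCL hr hγ hs0 hs1

/-- **`S_N22 RRec` FOR EVERY `RRec` WHOSE BUNDLES CARRY THE STRIP TOWER SLOT** (refinement-generic closer; the strip-currency twin of
`YMDAG.N22.s_N22_of_towerSlot`): every bundle of record IS a level `k` of a tower of carriers with the letters of
`n22At_level_of_n18At_below_strip`, node N18 holds at the levels `k′ < k`, and the level functional has (P) + (A′). [folklore] -/
theorem s_N22_of_towerSlot_strip (RRec : RateRecordPred N)
    (hslot : ∀ (F : T4Family) (D : Datum F N) (g₀ : ℕ → ℝ) (os : List (ULoop F)) (R : RateCarriers N), RRec F D g₀ os R →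
      ∃ (T : TowerData) (E : ℕ → (ℕ → ℝ) → T.B → T.Dom → ℝ) (γ κ θ C₅ L μ r s cr ρ' : ℝ) (k : ℕ),
        R.u3 = ⟨T.level k, Window γ, γ, κ, E k, fun b g U X => E (k + 1) (prepend b g) U X, θ, C₅,
          fun a i => 32 / (s ^ 2 * min (r / 2) (γ / 2)) * ((2 * C₅ / (1 - θ)) ^ (1 - s) * (2 * (L * r)) ^ s) / (θ ^ (1 - s) * μ ^ s)
            * (θ ^ (1 - s) * μ ^ s) ^ (a - i),
          32 / (s ^ 2 * min (r / 2) (γ / 2)) * ((2 * C₅ / (1 - θ)) ^ (1 - s) * (2 * (L * r)) ^ s) / (θ ^ (1 - s) * μ ^ s),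
          θ ^ (1 - s) * μ ^ s, cr, ρ'⟩ ∧
        0 < C₅ ∧ 0 < θ ∧ θ < 1 ∧
        (∀ k' : ℕ, k' < k →
          N18At ⟨T.level k', Window γ, γ, κ, E k', fun b g U X => E (k' + 1) (prepend b g) U X, θ, C₅,
            fun a i => 32 / (s ^ 2 * min (r / 2) (γ / 2)) * ((2 * C₅ / (1 - θ)) ^ (1 - s) * (2 * (L * r)) ^ s) / (θ ^ (1 - s) * μ ^ s)
              * (θ ^ (1 - s) * μ ^ s) ^ (a - i),
            32 / (s ^ 2 * min (r / 2) (γ / 2)) * ((2 * C₅ / (1 - θ)) ^ (1 - s) * (2 * (L * r)) ^ s) / (θ ^ (1 - s) * μ ^ s),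
            θ ^ (1 - s) * μ ^ s, cr, ρ'⟩) ∧
        PrefixDependenceOn (C := T.level k) (E k) (Window γ) ∧
        (∀ g ∈ Window γ, ∀ (U : (T.level k).BgA) (X : (T.level k).Dom) (i : ℕ), i < (T.level k).scale X →
          ∃ (Fz : ℂ → ℂ) (Dset : Set ℂ), DifferentiableOn ℂ Fz Dset ∧
            (∀ z ∈ Dset, ‖deriv Fz z‖ ≤ L * μ ^ ((T.level k).scale X - 1 - i) * Real.exp (-(κ * (T.level k).d X))) ∧
            (∀ t ∈ Ioc (0 : ℝ) γ, ball (t : ℂ) r ⊆ Dset) ∧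
            (∀ t ∈ Ioc (0 : ℝ) γ, Fz t = (E k (Function.update g i t) U X : ℂ))) ∧
        0 < L ∧ θ ≤ μ ∧ 2 * C₅ / (1 - θ) ≤ 2 * (L * r) ∧ 0 < r ∧ 0 < γ ∧ 0 < s ∧ s < 1) :
    S_N22 RRec := by
  intro F D g₀ os R hR
  obtain ⟨T, E, γ, κ, θ, C₅, L, μ, r, s, cr, ρ', k, hu, hC, hθ0, hθ1, h18, hP, hA, hL, hθμ, hCL, hr, hγ, hs0, hs1⟩ :=
    hslot F D g₀ os R hR
  rw [hu]
  exact n22At_level_of_n18At_below_strip T E hC hθ0 hθ1 k h18 hP hA hL hθμ hCL hr hγ hs0 hs1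

/-! ## §3 Choosing `s`: on ROAD 3 a FADING letter `ω < 1` is available iff node N18's rate is `θ < 1`, whatever the growth `μ` -/

/-- **A FADING RATE EXISTS WHENEVER `θ < 1`** (answers dag-ref-B's READING PINS of READ-267 ∕ READ-278: `T4OutputRate.FadingMemory C₉ ω Λ` carries no
`ω < 1`; on ROAD 3 the consumer ∕ the `RRec` author chooses `s`): for `0 < θ < 1` and ANY `μ ≥ θ` there is `s ∈ ]0, 1[` with `θ^{1−s}μ^{s} < 1` —
explicitly `s = a ∕ (2(a + b))`, `a = −log θ > 0`, `b = log(μ∕θ) ≥ 0` (then `s·b ≤ a∕2 < a`).  So the strip ∕ analytic slots of record can always be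
instanced with a fading letter `ω = θ^{1−s}μ^{s} < 1` once node N18 supplies `θ < 1`; the growth `μ` only lowers the admissible `s`. [folklore] -/
theorem exists_fading_rate {θ μ : ℝ} (hθ0 : 0 < θ) (hθ1 : θ < 1) (hθμ : θ ≤ μ) :
    ∃ s : ℝ, 0 < s ∧ s < 1 ∧ θ ^ (1 - s) * μ ^ s < 1 := by
  have hμ : 0 < μ := hθ0.trans_le hθμ
  set a : ℝ := -Real.log θ with ha_def
  set b : ℝ := Real.log μ - Real.log θ with hb_def
  have ha : 0 < a := by have := Real.log_neg hθ0 hθ1; rw [ha_def]; linarith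
  have hb : 0 ≤ b := by have := Real.log_le_log hθ0 hθμ; rw [hb_def]; linarith
  have hab : 0 < 2 * (a + b) := by positivity
  refine ⟨a / (2 * (a + b)), div_pos ha hab, ?_, ?_⟩
  · rw [div_lt_one hab]; linarith
  · set s : ℝ := a / (2 * (a + b)) with hs_def
    have hs0 : 0 ≤ s := (div_pos ha hab).le
    have hsb : s * b < a := by
      have h1 : s * b ≤ s * (a + b) := mul_le_mul_of_nonneg_left (by linarith) hs0
      have h2 : s * (a + b) = a / 2 := by rw [hs_def]; field_simp
      linarith
    rw [Real.rpow_def_of_pos hθ0, Real.rpow_def_of_pos hμ, ← Real.exp_add, Real.exp_lt_one_iff]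
    have e : Real.log θ * (1 - s) + Real.log μ * s = -a + s * b := by rw [ha_def, hb_def]; ring
    rw [e]
    linarith

/-- **… AND ONLY THEN**: if `1 ≤ θ ≤ μ` then every ROAD-3 letter is at least one (`1 ≤ θ^{1−s}μ^{s}` for `0 ≤ s ≤ 1`) — no fading without
node N18's `θ < 1`, as the census says. [folklore] -/
theorem one_le_rate_of_one_le {θ μ s : ℝ} (hθ : 1 ≤ θ) (hθμ : θ ≤ μ) (hs0 : 0 ≤ s) (hs1 : s ≤ 1) :
    1 ≤ θ ^ (1 - s) * μ ^ s := by
  have h1 : 1 ≤ θ ^ (1 - s) := Real.one_le_rpow hθ (by linarith)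
  have h2 : 1 ≤ μ ^ s := Real.one_le_rpow (hθ.trans hθμ) hs0
  nlinarith

/-! ## §4 Currency ordering: the UNCENTRED analytic letter (A) of `N22KnitTwoConstants` ∕ `…AtRecordAnalytic` implies the strip letter (A′)
(Cauchy's estimate, n22-b module 13 §5 `letters_of_norm_le` BY NAME) — module 10's headline is a corollary of the strip headline -/

/-- **(A) ⟹ (A′): A SUP LETTER ON THE CLOSED `r`-DISCS IS A DERIVATIVE LETTER ON THE OPEN `r∕2`-DISCS.**  If every young-coupling section extends to `F`
on `D ⊇ D̄(t, r)` (`t ∈ ]0, γ]`) with `‖F‖ ≤ M·μ^{age−1}·e^{−κd(X)}` on `D`, then (same `F`) on `D′ = ⋃_{t ∈ ]0,γ]} D(t, r∕2)` the derivative letter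
`‖F′‖ ≤ (2M∕r)·μ^{age−1}·e^{−κd(X)}` holds (Cauchy on the circle of radius `r∕2`: `B12Eq213AnalyticHistory.letters_of_norm_le`) and `D′ ⊇ D(t, r∕2)`.
So the derivative-letter currency (A′) is the WEAKEST of ROAD 3's three E-side currencies. [folklore] -/
theorem stripLetter_of_supLetter {C : Carriers} {Bg : Type} {E : Functional C Bg} {γ κ M μ r : ℝ} (hr : 0 < r)
    (hA : ∀ g ∈ Window γ, ∀ (U : Bg) (X : C.Dom) (i : ℕ), i < C.scale X → ∃ (F : ℂ → ℂ) (D : Set ℂ),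
      DifferentiableOn ℂ F D ∧ (∀ z ∈ D, ‖F z‖ ≤ M * μ ^ (C.scale X - 1 - i) * Real.exp (-(κ * C.d X))) ∧
      (∀ t ∈ Ioc (0 : ℝ) γ, closedBall (t : ℂ) r ⊆ D) ∧ (∀ t ∈ Ioc (0 : ℝ) γ, F t = (E (Function.update g i t) U X : ℂ))) :
    ∀ g ∈ Window γ, ∀ (U : Bg) (X : C.Dom) (i : ℕ), i < C.scale X → ∃ (F : ℂ → ℂ) (D : Set ℂ),
      DifferentiableOn ℂ F D ∧ (∀ z ∈ D, ‖deriv F z‖ ≤ 2 * M / r * μ ^ (C.scale X - 1 - i) * Real.exp (-(κ * C.d X))) ∧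
      (∀ t ∈ Ioc (0 : ℝ) γ, ball (t : ℂ) (r / 2) ⊆ D) ∧ (∀ t ∈ Ioc (0 : ℝ) γ, F t = (E (Function.update g i t) U X : ℂ)) := by
  intro g hg U X i hi
  obtain ⟨F, D, hF, hB, hD, hf⟩ := hA g hg U X i hi
  refine ⟨F, ⋃ t ∈ Ioc (0 : ℝ) γ, ball (t : ℂ) (r / 2), hF.mono ?_, ?_, fun t ht => ?_, hf⟩
  · intro z hz
    obtain ⟨t, ht, hzt⟩ := mem_iUnion₂.1 hz
    exact hD t ht (ball_subset_closedBall (ball_subset_ball (by linarith) hzt))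
  · intro z hz
    obtain ⟨t, ht, hzt⟩ := mem_iUnion₂.1 hz
    have hball : ball (t : ℂ) r ⊆ D := ball_subset_closedBall.trans (hD t ht)
    have h := (letters_of_norm_le (c := (t : ℂ)) (by linarith : r / 2 < r) (hF.mono hball) (fun w hw => hB w (hball hw))).2 z hzt
    have e : M * μ ^ (C.scale X - 1 - i) * Real.exp (-(κ * C.d X)) / (r - r / 2)
        = 2 * M / r * μ ^ (C.scale X - 1 - i) * Real.exp (-(κ * C.d X)) := by
      field_simp
      ring
    rw [← e]
    exact h
  · exact subset_iUnion₂ (s := fun (t : ℝ) (_ : t ∈ Ioc (0 : ℝ) γ) => ball (t : ℂ) (r / 2)) t ht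

/-- **MODULE 10's HEADLINE AS A COROLLARY OF THE STRIP HEADLINE** (currency ordering, kernel-checked): under the hypotheses of
`N22KnitTwoConstants.ne9_and_fadingMemory_of_osc_analytic_rpow` — (P), (O), the UNCENTRED letter (A) on the closed `r`-discs, `θ ≤ μ`, `C₀ ≤ 2M` — the strip
road (`N22KnitStrip.ne9_and_fadingMemory_of_osc_strip` at `L = 2M∕r`, radius `r∕2`, via `stripLetter_of_supLetter`) gives node N22's statement of record with
the SAME rate `τ_s = θ^{1−s}μ^{s}` and the constant `C₉ = (32∕(s²·min(r∕4, γ∕2)))·C₀^{1−s}(2M)^{s}∕τ_s` (module 10's, with `r₁ = min(r∕2, γ∕2)` replaced by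
`min(r∕4, γ∕2)`). [folklore] -/
theorem ne9_and_fadingMemory_of_osc_analytic_via_strip {C : Carriers} {Bg : Type} {E : Functional C Bg} {γ κ C₀ θ M μ r s : ℝ}
    (hP : PrefixDependenceOn E (Window γ))
    (hO : ∀ g ∈ Window γ, ∀ g' ∈ Window γ, ∀ (U : Bg) (X : C.Dom) (a : ℕ), a ≤ C.scale X →
      (∀ n, a ≤ n → g n = g' n) → |E g U X - E g' U X| ≤ C₀ * θ ^ (C.scale X - a) * Real.exp (-(κ * C.d X)))
    (hA : ∀ g ∈ Window γ, ∀ (U : Bg) (X : C.Dom) (i : ℕ), i < C.scale X → ∃ (F : ℂ → ℂ) (D : Set ℂ),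
      DifferentiableOn ℂ F D ∧ (∀ z ∈ D, ‖F z‖ ≤ M * μ ^ (C.scale X - 1 - i) * Real.exp (-(κ * C.d X))) ∧
      (∀ t ∈ Ioc (0 : ℝ) γ, closedBall (t : ℂ) r ⊆ D) ∧ (∀ t ∈ Ioc (0 : ℝ) γ, F t = (E (Function.update g i t) U X : ℂ)))
    (hC₀ : 0 < C₀) (hθ : 0 < θ) (hM : 0 < M) (hθμ : θ ≤ μ) (hCM : C₀ ≤ 2 * M) (hr : 0 < r) (hγ : 0 < γ) (hs0 : 0 < s) (hs1 : s < 1) :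
    NE9 E (Window γ) κ
        (fun k i => 32 / (s ^ 2 * min (r / 4) (γ / 2)) * (C₀ ^ (1 - s) * (2 * M) ^ s) / (θ ^ (1 - s) * μ ^ s)
          * (θ ^ (1 - s) * μ ^ s) ^ (k - i)) ∧
      FadingMemory (32 / (s ^ 2 * min (r / 4) (γ / 2)) * (C₀ ^ (1 - s) * (2 * M) ^ s) / (θ ^ (1 - s) * μ ^ s))
        (θ ^ (1 - s) * μ ^ s)
        (fun k i => 32 / (s ^ 2 * min (r / 4) (γ / 2)) * (C₀ ^ (1 - s) * (2 * M) ^ s) / (θ ^ (1 - s) * μ ^ s)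
          * (θ ^ (1 - s) * μ ^ s) ^ (k - i)) := by
  have hL : 0 < 2 * M / r := by positivity
  have e1 : 2 * (2 * M / r * (r / 2)) = 2 * M := by field_simp
  have e2 : r / 2 / 2 = r / 4 := by ring
  have hCL : C₀ ≤ 2 * (2 * M / r * (r / 2)) := by rw [e1]; exact hCM
  have key := ne9_and_fadingMemory_of_osc_strip hP hO (stripLetter_of_supLetter hr hA) hC₀ hθ hL hθμ hCL (half_pos hr) hγ hs0 hs1
  rw [e1, e2] at key
  exact key

end YMDAG.N22

end
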